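import Literature.Topology.FourManifolds.HomotopySpheresStablyParallelizableStability
import HarnessLib

/-!
# One rung below the stable range: `π₆(SO(7), 1) = 0` already implies `Bott1959_sphereMapsToStableFramesExtend_six`

Topic `Literature/Topology/FourManifolds`, a short appendix to
`HomotopySpheresStablyParallelizableStability.lean` (kept separate so that the addition is a pure
proof file). That file proved the stability theorem for
`ι_* : πₙ(SO(D), 1) → πₙ(SO(D + 1), 1)` — onto for `n < D`
(`SOTransport.surjective_homotopyGroupMap_inclSO`, needing only `πₙ(𝕊ᴰ) = 0`), one-to-one for
`n + 1 < D` — and restated the named fact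
`Literature.Topology.FourManifolds.Bott1959_sphereMapsToStableFramesExtend_six` (`= π₆(SO(8), 1) = 0`)
in terms of `SO(D)` for all / some `D ≥ 8` (Hatcher, *Algebraic Topology*, §4.2, Example 4.55 and
the paragraph after it; Bott 1959, §1, Corollary to Thm. II, (1.5)). The surjectivity half alone
reaches one rung lower (everything PROVED, no definitions, no named facts):

* `Literature.Topology.FourManifolds.subsingleton_homotopyGroup_specialOrthogonalGroup_succ_of`:
  for `n < D`, `πₙ(SO(D), 1) = 0 → πₙ(SO(D + 1), 1) = 0`;
* `Literature.Topology.FourManifolds.sphereMapsToStableFramesExtend_of_specialOrthogonalGroup_succ`: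
  `πₙ(SO(n + 1), 1) = 0 → SphereMapsToStableFramesExtend n` (`n ≥ 1`);
* `Literature.Topology.FourManifolds.Bott1959_sphereMapsToStableFramesExtend_six_of_specialOrthogonalGroup_seven`:
  `π₆(SO(7), 1) = 0 → Bott1959_sphereMapsToStableFramesExtend_six` (`π₆(SO(7)) → π₆(SO(8))` is onto
  as `π₆(𝕊⁷) = 0`; by Bott's table `π₆(SO(7)) = 0` too — `6 = 7 - 1` is outside the injectivity
  range only, and `SO(8) ≈ S⁷ × SO(7)` by octonions, Hatcher §3.D, held copy p. 379, which is not needed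
  here).

What is NOT proved: `π₆(SO(7), 1) = 0` (equivalently `π₆(SO(8), 1) = 0`): Bott periodicity.

## References

* R. Bott, *The stable homotopy of the classical groups*, Ann. of Math. (2) 70 (1959), §1,
  Corollary to Theorem II, (1.5), p. 315. doi:10.2307/1970106 [Bott1959]
* A. Hatcher, *Algebraic Topology*, CUP (2002), §4.2, Example 4.55 and the paragraph after it
  (held copy pp. 498–499). [HatcherAT2002]
-/

noncomputable section

namespace Literature.Topology.FourManifolds

open SOTransport Literature.AlgebraicTopology.Homotopy
open scoped _root_.Topology

variable {D n : ℕ}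

/-- **One-step vanishing below the stable range**: for `n < D`, `πₙ(SO(D), 1) = 0` implies
`πₙ(SO(D + 1), 1) = 0` (the surjectivity half of stability,
`SOTransport.surjective_homotopyGroupMap_inclSO`, which needs only `πₙ(𝕊ᴰ) = 0`).
[cite: HatcherAT2002, §4.2, Example 4.55] -/
theorem subsingleton_homotopyGroup_specialOrthogonalGroup_succ_of (hn : n < D)
    (h : Subsingleton (π_ n (Matrix.specialOrthogonalGroup (Fin D) ℝ) 1)) :
    Subsingleton (π_ n (Matrix.specialOrthogonalGroup (Fin (D + 1)) ℝ) 1) := by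
  haveI := h
  have hs : Subsingleton (HomotopyGroup (Fin n) (Matrix.specialOrthogonalGroup (Fin (D + 1)) ℝ)
      (inclSO (1 : Matrix.specialOrthogonalGroup (Fin D) ℝ))) :=
    (surjective_homotopyGroupMap_inclSO (D := D) (n := n) hn).subsingleton
  rwa [inclSO_one] at hs

/-- **`πₙ(SO(n + 1), 1) = 0` implies the extension property `SphereMapsToStableFramesExtend n`**
(`n ≥ 1`; one rung below the stable range `D ≥ n + 2` of
`sphereMapsToStableFramesExtend_iff_forall_specialOrthogonalGroup`). [cite: HatcherAT2002, §4.2, Example 4.55] -/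
theorem sphereMapsToStableFramesExtend_of_specialOrthogonalGroup_succ (hn : 1 ≤ n)
    (h : Subsingleton (π_ n (Matrix.specialOrthogonalGroup (Fin (n + 1)) ℝ) 1)) :
    SphereMapsToStableFramesExtend n :=
  (sphereMapsToStableFramesExtend_iff_subsingleton_homotopyGroup_specialOrthogonalGroup hn).mpr
    (subsingleton_homotopyGroup_specialOrthogonalGroup_succ_of (Nat.lt_succ_self n) h)

/-- **`π₆(SO(7), 1) = 0` implies the named fact `Bott1959_sphereMapsToStableFramesExtend_six`**
(`π₆(SO(7)) → π₆(SO(8))` is onto as `π₆(𝕊⁷) = 0`; Bott: `π₆(SO(7)) = π₆(SO) = 0`).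
[cite: Bott1959, §1, Corollary to Theorem II, (1.5), p. 315] -/
theorem Bott1959_sphereMapsToStableFramesExtend_six_of_specialOrthogonalGroup_seven
    (h : Subsingleton (π_ 6 (Matrix.specialOrthogonalGroup (Fin 7) ℝ) 1)) :
    Bott1959_sphereMapsToStableFramesExtend_six :=
  sphereMapsToStableFramesExtend_of_specialOrthogonalGroup_succ (n := 6) (by norm_num) h

end Literature.Topology.FourManifolds

end
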